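import Literature.Barriers.NavierStokesRegularity.DiffeomorphismNonInvarianceGauge
import HarnessLib

/-!
# Barrier: the Navier–Stokes system is not diffeomorphism-covariant — conjugating a solution by a
# smooth volume-preserving coordinate gauge does not give a solution, so regularity theorems for a
# symmetry class do not transfer through a gauge (Fushchich–Shtelen–Slavutsky 1991 §1 (1.2)–(1.3);
# Majda–Bertozzi 2002 §1.2; Acheson 1990 §2.3 (2.9))

Barrier catalogue entry for `NavierStokesRegularity` (D-0021), METHOD LEVEL, everything PROVED (zero
fact debt), filed by the D-0090 NS-CLAIMS cell (salvage seat `ns-claims-salvage-p6`) for the map's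
mechanism class «coordinate elimination / gauge transfer by (time-dependent) diffeomorphisms» — the
class of row C170 (`Literature.Claims.NS.Vukolov2026`: «a time-dependent diffeomorphism that
eliminates one spatial coordinate, reducing an arbitrary 3D flow to a 2D flow; a second … into an
axisymmetric flow without swirl … by the regularity of axisymmetric flows, every such initial data
yields a globally regular solution», abstract p. 1; gauge displays (5)–(8) p. 11, conjugated system
(47) p. 23). Sibling of `GalileanFrameSlot` (which records what the extended Galilei group DOES
transfer) and of `ParallelShearSlot` (whose necessity direction, Acheson (2.9), is the engine here).
The locator of record of any row is the refuter's; this file is the §2 method cell.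

## What is printed

* Fushchich–Shtelen–Slavutsky, J. Phys. A 24 (1991) 971–984, §1 p. 971: the Navier–Stokes equations
  (1.1) «are invariant under the extended Galilei group G̃(1,3) generated by» `∂ₜ`, `∂ₐ`,
  `Gₐ = t∂ₐ + ∂_{uₐ}`, `J_{ab}`, `D = 2t∂ₜ + xₐ∂ₐ − uₐ∂_{uₐ} − 2p∂ₚ` (1.2), and «it was shown
  (Ovsyannikov, Lloyd) that the maximal, in the sense of Lie, invariance algebra of the NS equations
  (1.1) is the direct sum of eleven-dimensional AG̃(1,3) (1.2) and infinite-dimensional algebra A∞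
  with basis elements `Q = fᵃ∂ₐ + ḟᵃ∂_{uₐ} − xₐf̈ᵃ∂ₚ`, `R = g∂ₚ` (1.3), where `fᵃ = fᵃ(t)` and
  `g = g(t)` are arbitrary». [FushchichShtelenSlavutsky1991] So the only point transformations of
  `(t, x, u, p)` mapping solutions to solutions are: time/space translations, time-dependent
  translations with the pressure correction `−x·f̈` (tree: `IsClassicalNSSolutionOn.galileanBoost`),
  rotations, the parabolic scaling (tree: `Supercritical.stDilation`), and pressure shifts `p + g(t)`.
  A general (time-dependent) diffeomorphism `x ↦ ψ_t(x)` acting on `u` as a vector field is NOT among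
  them.
* Majda–Bertozzi 2002, §1.2: the symmetry groups of the Euler and Navier–Stokes equations (Galilean
  invariance, rotation symmetry, scale invariance). [MajdaBertozziCUP2002]
* Acheson 1990, §2.3 (2.8)–(2.9): for a parallel shear velocity the Navier–Stokes system forces
  `∂p/∂y = ∂p/∂z = 0` and «`∂p/∂x` must be a function of `t` alone». [Acheson1990] (Tree:
  `ParallelShear.gradient_eq_of_isClassicalNSSolutionOn_shear`; the «function of `t` alone» clause is
  proved here as `ParallelShear.eq_of_gradient_eq_smul_single`.)

## What is formalised (everything is a theorem of the tree, standard axioms)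

Two family files — `DiffeomorphismNonInvarianceFamily` (static gauge, the obstruction) and
`DiffeomorphismNonInvarianceGauge` (time-dependent gauge switched on from the identity, the laws) —
namespace `…NavierStokesRegularity.DiffeoGauge`, on `ℝ³ = EuclideanSpace ℝ (Fin 3)`:
* `pushforward ψ ψinv v y = Dψ(ψ⁻¹y) · v(ψ⁻¹y)` — the push-forward `ψ_* v` of a vector field by a map
  with two-sided inverse (display (6) p. 11 of the C170 text: `(ψ_t)_*V_ax = (Dψ_t)V_ax ∘ ψ_t⁻¹`);
  `pullback ψ ψinv := pushforward ψinv ψ` (`ψ^* = (ψ⁻¹)_*`, the §5.6 p. 23 operation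
  `V_ax(t) := ψ_t^* V(t)`).
* THE GAUGE: the cubic shear map `shearMap cubic x = x + (x₁³/6) e₀`, inverse
  `shearMapInv cubic y = y − (y₁³/6) e₀` — smooth, polynomial, mutual inverses
  (`leftInverse_shearMap`, `rightInverse_shearMap`, `contDiff_shearMap(Inv)`), with
  `Dψ(x) v = v + v₁ (x₁²/2) e₀` (`fderiv_shearMap_apply`; unipotent, `det Dψ ≡ 1`: volume-preserving,
  isotopic to the identity through `x + τ(x₁³/6)e₀`).
* THE SOLUTION: the uniform stream `u ≡ c e₁`, `p ≡ 0`, an unforced classical solution for every `ν`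
  on every time set of unique differentiability (`isClassicalNSSolutionOn_uniformStream`, from
  `FrameSlot.isClassicalNSSolutionOn_stream`).
* THE CONJUGATE: `ψ_*(c e₁) = bentStream c = (c y₁²/2) e₀ + c e₁` (`pushforward_shearMap_stream`) —
  divergence-free (`isDivFree_bentStream`: the constraint IS gauge-covariant for volume-preserving
  `ψ`), planar (`bentStream_planar`: independent of `y₂`, no `e₂`-component — it lands in the «2D»
  class whose global regularity is a theorem), with `(v·∇)v = c² y₁ e₀` (`convect_bentStream`) and
  `Δv = c e₀` (`laplacian_bentStream`).
* THE OBSTRUCTION: if `(bentStream c, q)` were a classical solution (any real `ν`, force `0`) on a time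
  set `S ∋ t`, the momentum equation gives `∇q(t,y) = (νc − c² y₁) e₀` (`gradient_pressure_bentStream`);
  by Acheson's necessity lemma (`ParallelShear.eq_of_gradient_eq_smul_single`: `∇q = K(y₁) e₀`
  everywhere ⇒ `K` constant, since `q` is then constant along `e₁` and `∇q` is `e₁`-translation
  invariant) this forces `c² = 0`. Hence `not_isClassicalNSSolutionOn_bentStream`: for `c ≠ 0`, EVERY
  `ν ∈ ℝ` (Euler included), every nonempty `S`, and every pressure `q`, `(v_c, q)` is not a solution;
  `not_isClassicalNSSolutionOn_pushforward_stream` restates it for `ψ_*(c e₁)`.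
* THE OBSTRUCTION IS LOCAL IN TIME: `not_isClassicalNSSolutionOn_of_eventuallyEq_bentStream` — any
  velocity that coincides with `v_c` for times near some `t ∈ S` admits no pressure on `S`.
* THE SWITCHED GAUGE (part 2): `gauge t x = x + λ(t)(x₁³/6) e₀` with `λ = Real.smoothTransition`
  (`λ(0) = 0`, `λ ≡ 1` on `[1, ∞)`) — the shape of the C170 text's own first gauge ((19) p. 15:
  interpolation from the identity to a fixed map, frozen for `t ≥ 1`) and a member of the class of its
  Definition 2.6 / the skeleton's `GaugeFamily` VERBATIM: jointly `C^∞` on `ℝ × ℝ³` with jointly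
  `C^∞` two-sided inverses (`contDiff_gauge_uncurry`, `contDiff_gaugeInv_uncurry`,
  `leftInverse_gauge`, `rightInverse_gauge`) and `ψ₀ = id` (`gauge_zero`). It conjugates the global
  smooth solution `c e₁` to a velocity that IS `c e₁` at `t = 0` and is the bent stream for `t ≥ 1`
  (`pushforward_gauge_stream`), hence (`not_isClassicalNSSolutionOn_gauge_stream`) to a NON-solution on
  `[0, ∞)` for every pressure and every real `ν`, `c ≠ 0`.
* THE LAWS: `PushforwardLaw ν S` («for every jointly smooth gauge family `ψ_t` with jointly smooth
  inverses and every classical solution `(W, r)` on `S`, `t ↦ (ψ_t)_* W(t)` is a classical solution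
  for some pressure»), `PullbackLaw ν S` (the same for `t ↦ ψ_t^* V(t)`) — FALSE for every `ν` on
  every nonempty time set of unique differentiability (`not_pushforwardLaw`, `not_pullbackLaw`) — and
  `IdGaugeLaw ν`, the law over the `GaugeFamily` class exactly (`IsSmoothSpaceTimeOn (Ici 0)` for `ψ`
  and `ψ⁻¹`, inverse identities for `t ≥ 0`, `ψ 0 = id`, reference field itself a global classical
  solution) — FALSE for every `ν` (`not_idGaugeLaw`). In the skeleton's words: membership
  «`(ψ_t)_* V_ax(t)` is a classical Navier–Stokes solution» (its `InA`, l. 221, whose `pushforward`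
  l. 181 is this file's `pushforward` up to the name) is a CONSTRAINT coupling `ψ_t` and `V_ax`, not a
  consequence of `V_ax` solving anything — which is why `InA` collapses to «a global solution exists»
  under the identity gauge (the skeleton's `inA_iff_globalSol`) and why a theorem about Euclidean
  solutions of a symmetry class (`Step_axisym` there) has no purchase on a gauge-manufactured `V_ax`.
* `DiffeomorphismNonInvariance` packages these; `diffeomorphismNonInvariance_holds` proves it.

## Structured block

technique_class: diffeomorphism-gauge-transfer coordinate-elimination-by-diffeomorphism
  symmetric-class-regularity-transfer conjugated-system-read-as-navier-stokes
  layer-by-layer-gauge density-closure-of-gaugeable-class (T11-adjacent: «transformation to a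
  solvable class»; the writers' table names the code)
blocks: every step, for classical solutions of the unforced system with any real `ν`, of the shapes
  (α) «`(W, r)` solves NS and `ψ_t` is a smooth (volume-preserving) gauge ⇒ `(ψ_t)_* W` solves NS
  for some pressure» (`not_pushforwardLaw`), (β) «`V` solves NS ⇒ the reference field
  `V_ax := ψ_t^* V` solves the (Euclidean) NS equations» (`not_pullbackLaw`; over the Definition-2.6 class with `ψ₀ = id`: `not_idGaugeLaw`) — and therefore (β′)
  «`V_ax` is axisymmetric without swirl / planar BY CONSTRUCTION of `ψ_t`, hence globally regular by
  the Euclidean theorem for that class» (tree doors `Literature.Analysis.FluidPDE.axisymmetric_no_swirl_global_regularity`,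
  PROVED `…_holds`; 2D Ladyzhenskaya): those theorems quantify over SOLUTIONS of the Euclidean system,
  and the conjugate of a solution is in general not one (`bentStream_planar` ∧
  `not_isClassicalNSSolutionOn_bentStream`: a planar conjugate of a global smooth solution that is no
  solution at all); (γ) density / closure / homotopy arguments that propagate «admits a global smooth
  conjugating gauge» along families of diffeomorphism-conjugates as if conjugation were a symmetry of
  the solution set [cite: FushchichShtelenSlavutsky1991, §1 eqs. (1.2)–(1.3) p. 971].
because: under `y = ψ(x)`, `u = ψ_* W`, the material derivative and the constraint transform
  tensorially but the Euclidean Laplacian and the Euclidean gradient do not — the conjugated field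
  solves a DIFFERENT system with the pulled-back metric `g = ψ^*δ` (`Δ_g`, `∇_g`, a Lie-transport
  term `L_U` for time-dependent `ψ_t`, `U = ∂ₜψ_t ∘ ψ_t⁻¹`; the C170 text's own (47) p. 23), whose
  coefficients are `Dψ_t` — i.e. the solution itself whenever `ψ_t` is built from the flow; on the
  witness the conjugated inertial term `c² y₁ e₀` is not a gradient modulo `νΔv = νc e₀`, for any `ν`
  [cite: Acheson1990, §2.3 eq. (2.9)]. The maximal Lie point symmetry algebra of NS contains no
  `x`-dependent deformation beyond rotations and scaling [cite: FushchichShtelenSlavutsky1991, §1 eq. (1.3) p. 971].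
evasions_known: (1) the extended Galilei group and the scaling DO transfer solutions (tree:
  `IsClassicalNSSolutionOn.galileanBoost`, `Torus.isClassicalNSSolutionOn_galileanBoost`,
  `Supercritical.isDistributionalNSSolutionOn_stDilation`; rotations) — a step using only these is
  untouched [cite: FushchichShtelenSlavutsky1991, §1 eq. (1.2) p. 971]; (2) genuinely symmetric DATA
  (axisymmetric, no swirl; planar) give symmetric SOLUTIONS by uniqueness and the class theorems then
  apply honestly (tree `axisymmetric_no_swirl_global_regularity_holds`) — the barrier bites only when
  the symmetry is manufactured by a gauge; (3) a proof that works with the conjugated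
  variable-coefficient system DIRECTLY and controls its coefficients a priori (independently of the
  unknown solution) is not blocked — that control is the entire difficulty, cf.
  `EnergySupercriticality` / `ScalingAudit` for what an honest a-priori bound must survive;
  (4) Lagrangian particle-relabelling acts on labels, not on the Eulerian field, and is not a gauge of
  this kind [cite: MajdaBertozziCUP2002, §1.2].
scope_caveats: (a) `ℝ³ = EuclideanSpace ℝ (Fin 3)`, unforced system, classical pointwise solutions
  in the tree sense `IsClassicalNSSolutionOn` (one-sided time derivative within the time set), any
  real `ν` (the witness is inviscid-robust); (b) the witness solution is the uniform stream (infinite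
  energy on `ℝ³`; it is the rest state in a moving frame), so a transfer law quantified ONLY over
  finite-energy / decaying solutions is outside the letter of conjunct (v) — not of its substance: the
  obstruction is local (a non-closed forced pressure gradient) and the `𝕋³` reading is immediate with
  the `2π`-periodic gauge `x + (−cos x₁) e₀`, whose conjugate of `e₁` is the Kolmogorov-profile field
  `(sin y₁) e₀ + e₁` (recorded, not formalised here); (c) the laws are stated for gauge families
  jointly smooth in `(t, x)` with jointly smooth two-sided inverses — the constant family (parts
  (iv)) and the family switched on from the identity by `Real.smoothTransition` (part (v), `ψ₀ = id`)
  are the witnesses; the obstruction is read off where the gauge is frozen (`t ≥ 1`), so no use is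
  made of `∂ₜψ_t` and nothing is said about conjugates while the gauge moves; (d) nothing here concerns the conjugated system (47) itself
  (which is a correct rewriting): the entry blocks reading Euclidean theorems onto its solutions
  [cite: Acheson1990, §2.3 eq. (2.9)].
status: established; every conjunct proved below (`diffeomorphismNonInvariance_holds`, standard
  axioms).

## References

* [FushchichShtelenSlavutsky1991] W. I. Fushchich, W. M. Shtelen, S. L. Slavutsky, *Reduction and
  exact solutions of the Navier–Stokes equations*, J. Phys. A: Math. Gen. 24 (1991) 971–984,
  doi:10.1088/0305-4470/24/5/012, §1 eqs. (1.1)–(1.3) p. 971 (maximal Lie invariance algebra of NS,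
  after Ovsyannikov and Lloyd, Acta Mech. 38 (1981) 85–98).
* [MajdaBertozziCUP2002] A. J. Majda, A. L. Bertozzi, *Vorticity and Incompressible Flow*, CUP 2002,
  §1.2 (symmetry groups of the Euler and Navier–Stokes equations).
* [Acheson1990] D. J. Acheson, *Elementary Fluid Dynamics*, OUP 1990, §2.3 eqs. (2.8)–(2.9).

WHAT THIS IS NOT: not a claim about NS regularity or blow-up; not a claim about any author beyond the
typed locator.
-/


noncomputable section

open Set Function InnerProductSpace
open scoped ContDiff Laplacian RealInnerProductSpace

namespace Literature.Barriers.NavierStokesRegularity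

open Literature.Analysis.FluidPDE Literature.Analysis.FluidPDE.ParallelShear DiffeoGauge

/-- **BARRIER `DiffeomorphismNonInvariance` — «a coordinate gauge is not a symmetry of the
Navier–Stokes system; regularity of a symmetry class does not transfer through it».** Conjunction of
the kernel facts of this file, for the cubic shear gauge `ψ(x) = x + (x₁³/6) e₀` of `ℝ³` (smooth,
polynomial inverse `y − (y₁³/6) e₀`, `det Dψ ≡ 1`) and the uniform stream `c e₁`:
(i) for every `ν, c` and every time set of unique differentiability the stream `(c e₁, 0)` is an
unforced classical solution; (ii) its push-forward `ψ_*(c e₁) = v_c = (c y₁²/2) e₀ + c e₁` is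
divergence-free and planar; (iii) for `c ≠ 0` NO pressure makes `v_c` a classical solution on any
nonempty time set, for ANY real `ν`; (iv) hence the push-forward AND the pull-back transfer laws
(time-dependent gauge families allowed; the gauge hypotheses — joint smoothness, two-sided smooth
inverse — are discharged inside the proofs) are false for every `ν` on `[0, ∞)`; (v) the switched
gauge `x + λ(t)(x₁³/6)e₀` starts at the identity, is jointly smooth with jointly smooth inverses, and
conjugates `c e₁` (`c ≠ 0`) to a non-solution on `[0, ∞)` for every pressure and every `ν`, so the
transfer law over the Definition-2.6 / `GaugeFamily` class (`IdGaugeLaw`) is false for every `ν`. See the module docstring for the structured block.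
[cite: FushchichShtelenSlavutsky1991, §1 eqs. (1.2)–(1.3) p. 971] -/
def DiffeomorphismNonInvariance : Prop :=
  (∀ (ν c : ℝ) (S : Set ℝ), UniqueDiffOn ℝ S →
      IsClassicalNSSolutionOn S ν 0 (fun (_ : ℝ) (_ : E3) => c • EuclideanSpace.single (1 : Fin 3) (1 : ℝ))
        (fun (_ : ℝ) (_ : E3) => (0 : ℝ))) ∧
  (∀ c : ℝ,
      pushforward (shearMap cubic) (shearMapInv cubic)
          (fun _ : E3 => c • EuclideanSpace.single (1 : Fin 3) (1 : ℝ)) = bentStream c ∧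
        VectorCalculus.IsDivFree (bentStream c) ∧
        ∀ (y : E3) (s : ℝ), bentStream c (y + s • EuclideanSpace.single (2 : Fin 3) (1 : ℝ)) = bentStream c y ∧
          bentStream c y 2 = 0) ∧
  (∀ (c : ℝ), c ≠ 0 → ∀ (ν : ℝ) (S : Set ℝ) (t : ℝ), t ∈ S → ∀ q : ℝ → E3 → ℝ,
      ¬ IsClassicalNSSolutionOn S ν 0 (fun _ : ℝ => bentStream c) q) ∧
  (∀ ν : ℝ, ¬ PushforwardLaw ν (Ici 0) ∧ ¬ PullbackLaw ν (Ici 0)) ∧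
  ((∀ x : E3, gauge 0 x = x) ∧ ContDiff ℝ ∞ (uncurry gauge) ∧ ContDiff ℝ ∞ (uncurry gaugeInv) ∧
      (∀ t, LeftInverse (gaugeInv t) (gauge t) ∧ RightInverse (gaugeInv t) (gauge t)) ∧
    (∀ (c : ℝ), c ≠ 0 → ∀ (ν : ℝ) (q : ℝ → E3 → ℝ),
      ¬ IsClassicalNSSolutionOn (Ici 0) ν 0
          (fun t => pushforward (gauge t) (gaugeInv t)
            (fun _ : E3 => c • EuclideanSpace.single (1 : Fin 3) (1 : ℝ))) q) ∧
    ∀ ν : ℝ, ¬ IdGaugeLaw ν)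

/-- **Discharge**: every conjunct of `DiffeomorphismNonInvariance` is a theorem of this file.
[cite: FushchichShtelenSlavutsky1991, §1 eqs. (1.2)–(1.3) p. 971] -/
theorem diffeomorphismNonInvariance_holds : DiffeomorphismNonInvariance :=
  ⟨fun ν c _ hS => isClassicalNSSolutionOn_uniformStream hS ν c,
    fun c => ⟨pushforward_shearMap_stream c, isDivFree_bentStream c, bentStream_planar c⟩,
    fun _ hc ν _ _ ht q => not_isClassicalNSSolutionOn_bentStream ht hc ν q,
    fun ν => ⟨not_pushforwardLaw ν (uniqueDiffOn_Ici 0) ⟨0, Set.mem_Ici.2 le_rfl⟩,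
      not_pullbackLaw ν (uniqueDiffOn_Ici 0) ⟨0, Set.mem_Ici.2 le_rfl⟩⟩,
    gauge_zero, contDiff_gauge_uncurry, contDiff_gaugeInv_uncurry,
    fun t => ⟨leftInverse_gauge t, rightInverse_gauge t⟩,
    fun _ hc ν q => not_isClassicalNSSolutionOn_gauge_stream hc ν q,
    not_idGaugeLaw⟩

/-- `DiffeomorphismNonInvariance` — `_holds` alias of `diffeomorphismNonInvariance_holds` above under the fact's exact name (appended
2026-08-28, D-0026 bookkeeping: the proof term is the existing theorem of this file; no statement,
definition or attribute is edited; no new named fact; the ledger's debt table listed the fact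
unproved). [cite: FushchichShtelenSlavutsky1991, §1 eqs. (1.2)–(1.3) p. 971] -/
theorem _root_.Literature.Barriers.NavierStokesRegularity.DiffeomorphismNonInvariance_holds :
    DiffeomorphismNonInvariance :=
  _root_.Literature.Barriers.NavierStokesRegularity.diffeomorphismNonInvariance_holds

end Literature.Barriers.NavierStokesRegularity

end
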